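import Literature.Barriers.BirchSwinnertonDyer.RankNotSumOfLocalInvariantsF3Cubic
import Literature.Barriers.BirchSwinnertonDyer.RankNotSumOfLocalInvariantsF3CubicPolys
import Literature.NumberTheory.NumberFields.GaussianPeriodEval
import Mathlib.FieldTheory.Galois.Abelian
import HarnessLib

/-!
# Barrier (BirchSwinnertonDyer), rank mod `3`: the four cubic subfields of `F₃`, made explicit

Companion to `RankNotSumOfLocalInvariantsF3Cubic.lean` (the named fact
`Literature.Barriers.BirchSwinnertonDyer.DokchitserDokchitser2011_descent_480a1_F3_cubic`: the
`2`-descent bounds `rk E(K_σ) ≤ 1` for `E = 480a1` over the fixed fields `K_σ = F₃^{⟨σ⟩}`,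
`σ ≠ 1`, of the field `F₃` of T. Dokchitser–V. Dokchitser, *A note on the Mordell–Weil rank
modulo `n`*, J. Number Theory 131 (2011), proof of Thm. 2 — "2-descent […] (e.g. using Magma, over
all minimal non-trivial subfields of `F_n`)"). To carry these four descents out one needs the
four cubic fields EXPLICITLY; this file identifies them:

* `per13`, `per103`: the cubic Gaussian periods `η₁₃ = ∑_{c cube mod 13} ζ^{103c}`,
  `η₁₀₃ = ∑_{c cube mod 103} ζ^{13c}` in `ℚ(ζ₁₃₃₉)`, roots of `f₁₃ = X³ + X² - 4X + 1` and
  `f₁₀₃ = X³ + X² - 34X - 61` (`per13_cubic`, `per103_cubic`, from the kernel-checked period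
  identities of `Literature/NumberTheory/NumberFields/GaussianPeriodEval.lean`);
* `mem_F₃_of_finrank_adjoin_eq_three`: an element of `ℚ(ζ₁₃₃₉)` of degree `3` over `ℚ` lies in
  `F₃ = ℚ(ζ₁₃₃₉)^H`, `H = {τ : τ¹³⁶ = 1}` (index-`3` subgroups of the abelian Galois group contain
  every element of order prime to `3`); hence `F₃.A = η₁₃`, `F₃.B = η₁₀₃ ∈ F₃`;
* `F₃.apply_eq_self_cases`: every `σ ∈ Gal(F₃/ℚ)` fixes `A`, or `B`, or `θ' = theta1339a A B`
  (root of `f' = X³ + X² - 446X + 248`), or `θ'' = theta1339b A B` (root of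
  `f'' = X³ + X² - 446X - 3769`) — `σ` permutes the roots `{A, A', A''}` of `f₁₃` and
  `{B, B', B''}` of `f₁₀₃` (`RankNotSumOfLocalInvariantsF3CubicPolys.lean`), and the nine cases
  are covered by the four invariants; so `F₃.exists_root_mem_cubicField`: each `K_σ` contains a
  root of one of `f₁₃, f₁₀₃, f', f''` (for `σ ≠ 1`, `K_σ` IS the corresponding cubic field:
  `K₁₃`, `K₁₀₃`, or one of the two cyclic cubic fields of conductor `1339`);
* `descent_480a1_F3_cubic_of_cubics`: CONSEQUENTLY the named fact follows from four statements
  about explicit cubics — for each `f ∈ {f₁₃, f₁₀₃, f', f''}`: every cubic Galois number field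
  containing a root of `f` has `rk_ℤ E(K) ≤ 1` — which are the four `2`-descents still to be
  carried out (no new named fact is introduced; they are hypotheses of this theorem).

## Design notes

`ζ₀ = IsCyclotomicExtension.zeta 1339 ℚ Cyclotomic1339`; the periods are `evalCyc` of the cube
indicator lists at `ζ₀¹⁰³`, `ζ₀¹³` (primitive `13`-th and `103`-rd roots of unity), so that the
period equations are literally `gaussPeriod13_eq_zero` / `gaussPeriod103_eq_zero`. No use is made
of the explicit Galois action `ζ ↦ ζᵃ`: membership in `F₃` is obtained from degrees alone. The
`IsAbelianGalois ℚ ↥F₃` instance is found under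
`set_option backward.isDefEq.respectTransparency false`, as in
`RankNotSumOfLocalInvariantsWeakSubfieldBoundsProofs.lean` (the `ℚ`-algebra diamond on `↥F₃`).

## References

* T. Dokchitser, V. Dokchitser, *A note on the Mordell–Weil rank modulo `n`*, J. Number Theory 131
  (2011) 1833–1839, arXiv:0910.4588: proof of Thm. 2 (p. 3 of the held arXiv copy).
  [DokchitserDokchitser2011RankModN]
* C. F. Gauss, *Disquisitiones Arithmeticae* (1801), art. 343–358 (Gaussian periods). [folklore]
-/

noncomputable section

open scoped NumberField

open NumberField WeierstrassCurve IntermediateField Polynomial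
open Literature.NumberTheory.NumberFields.GaussianPeriod

namespace Literature.Barriers.BirchSwinnertonDyer

namespace DokchitserDokchitser2011

open Cyclotomic1339

/-! ### Gaussian periods in `ℚ(ζ₁₃₃₉)` -/

/-- A primitive `1339`-th root of unity `ζ` in `ℚ(ζ₁₃₃₉)` (Mathlib `IsCyclotomicExtension.zeta`).
[folklore] -/
def ζ₀ : Cyclotomic1339 := IsCyclotomicExtension.zeta 1339 ℚ Cyclotomic1339

/-- `ζ` is a primitive `1339`-th root of unity. [folklore] -/
theorem isPrimitiveRoot_ζ₀ : IsPrimitiveRoot ζ₀ 1339 :=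
  IsCyclotomicExtension.zeta_spec 1339 ℚ Cyclotomic1339

/-- `ζ¹⁰³` is a primitive `13`-th root of unity. [folklore] -/
theorem isPrimitiveRoot_ζ₀_pow_103 : IsPrimitiveRoot (ζ₀ ^ 103) 13 :=
  isPrimitiveRoot_ζ₀.pow (by norm_num) (by norm_num)

/-- `ζ¹³` is a primitive `103`-rd root of unity. [folklore] -/
theorem isPrimitiveRoot_ζ₀_pow_13 : IsPrimitiveRoot (ζ₀ ^ 13) 103 :=
  isPrimitiveRoot_ζ₀.pow (by norm_num) (by norm_num)

/-- **The cubic Gaussian period of `13`** in `ℚ(ζ₁₃₃₉)`: `η₁₃ = ω + ω⁵ + ω⁸ + ω¹²`, `ω = ζ¹⁰³`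
(sum over the cubes modulo `13`), written with the list evaluator `evalCyc`.
[cite: DokchitserDokchitser2011RankModN, proof of Thm. 2] -/
def per13 : Cyclotomic1339 := evalCyc (ζ₀ ^ 103) ind13

/-- **The cubic Gaussian period of `103`** in `ℚ(ζ₁₃₃₉)`: `η₁₀₃ = ∑_{c cube mod 103} ωᶜ`,
`ω = ζ¹³`. [cite: DokchitserDokchitser2011RankModN, proof of Thm. 2] -/
def per103 : Cyclotomic1339 := evalCyc (ζ₀ ^ 13) ind103

/-- `η₁₃` is a root of `f₁₃ = X³ + X² - 4X + 1` (Gauss's period equation for `13`).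
[folklore] -/
theorem per13_cubic : per13 ^ 3 + per13 ^ 2 - 4 * per13 + 1 = 0 :=
  gaussPeriod13_eq_zero _ isPrimitiveRoot_ζ₀_pow_103.pow_eq_one
    (isPrimitiveRoot_ζ₀_pow_103.geom_sum_eq_zero (by norm_num))

/-- `η₁₀₃` is a root of `f₁₀₃ = X³ + X² - 34X - 61` (Gauss's period equation for `103`).
[folklore] -/
theorem per103_cubic : per103 ^ 3 + per103 ^ 2 - 34 * per103 - 61 = 0 :=
  gaussPeriod103_eq_zero _ isPrimitiveRoot_ζ₀_pow_13.pow_eq_one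
    (isPrimitiveRoot_ζ₀_pow_13.geom_sum_eq_zero (by norm_num))

/-! ### The periods lie in `F₃` -/

/-- **An element of `ℚ(ζ₁₃₃₉)` generating a cubic extension of `ℚ` lies in `F₃`.** If
`[ℚ(x) : ℚ] = 3` then the fixing group `N` of `ℚ(x)` has index `3` in the abelian group
`Gal(ℚ(ζ₁₃₃₉)/ℚ)`, so every `τ` with `τ¹³⁶ = 1` lies in `N` (its image in `G/N ≅ C₃` is killed
by `136` and by `3`), i.e. `H ≤ N` and `x ∈ ℚ(ζ₁₃₃₉)^H = F₃`. [folklore] -/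
theorem mem_F₃_of_finrank_adjoin_eq_three {x : Cyclotomic1339}
    (hx : Module.finrank ℚ ℚ⟮x⟯ = 3) : x ∈ F₃ := by
  rw [F₃, IntermediateField.mem_fixedField_iff]
  intro τ hτ
  rw [F₃.mem_subgroup_iff] at hτ
  have hτ136 : τ ^ 136 = 1 := galEquiv.injective (by rw [map_pow, hτ, map_one])
  set N : Subgroup Gal(Cyclotomic1339/ℚ) := (ℚ⟮x⟯).fixingSubgroup with hN
  -- `|N| = [ℚ(ζ₁₃₃₉) : ℚ(x)]` and `[G : N] = 3`
  have hcardN : Nat.card N = Module.finrank ℚ⟮x⟯ Cyclotomic1339 :=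
    IsGalois.card_fixingSubgroup_eq_finrank ℚ⟮x⟯
  have hcardG : Nat.card Gal(Cyclotomic1339/ℚ) = 1224 := by
    rw [IsGalois.card_aut_eq_finrank, Cyclotomic1339.finrank_eq]
  have htower :
      Module.finrank ℚ ℚ⟮x⟯ * Module.finrank ℚ⟮x⟯ Cyclotomic1339 = 1224 := by
    rw [Module.finrank_mul_finrank, Cyclotomic1339.finrank_eq]
  have hindex : N.index = 3 := by
    have h1 := N.index_mul_card
    rw [hcardN, hcardG] at h1
    rw [hx] at htower
    have h2 : Module.finrank (↥ℚ⟮x⟯) Cyclotomic1339 = 408 := by omega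
    rw [h2] at h1
    omega
  -- the image of `τ` in `G ⧸ N` (a group of order `3`) is trivial
  haveI : N.Normal := inferInstance
  have hq3 : (QuotientGroup.mk τ : Gal(Cyclotomic1339/ℚ) ⧸ N) ^ 3 = 1 := by
    have : Nat.card (Gal(Cyclotomic1339/ℚ) ⧸ N) = 3 := by
      rw [← Subgroup.index_eq_card, hindex]
    rw [← this]
    exact pow_card_eq_one'
  have hq136 : (QuotientGroup.mk τ : Gal(Cyclotomic1339/ℚ) ⧸ N) ^ 136 = 1 := by
    rw [← QuotientGroup.mk_pow, hτ136, QuotientGroup.mk_one]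
  have hq : (QuotientGroup.mk τ : Gal(Cyclotomic1339/ℚ) ⧸ N) = 1 := by
    have h := hq136
    rw [show (136 : ℕ) = 3 * 45 + 1 by norm_num, pow_add, pow_mul, hq3, one_pow, one_mul,
      pow_one] at h
    exact h
  have hτN : τ ∈ N := (QuotientGroup.eq_one_iff τ).mp hq
  rw [hN, IntermediateField.mem_fixingSubgroup_iff] at hτN
  exact hτN x (IntermediateField.mem_adjoin_simple_self ℚ x)

/-- `[ℚ(η₁₃) : ℚ] = 3`: `f₁₃` is irreducible, hence the minimal polynomial of `η₁₃`. [folklore] -/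
theorem finrank_adjoin_per13 : Module.finrank ℚ ℚ⟮per13⟯ = 3 := by
  have hint : IsIntegral ℚ per13 := .of_finite ℚ per13
  have hmin : minpoly ℚ per13 = X ^ 3 + C (1 : ℚ) * X ^ 2 + C (-4 : ℚ) * X + C (1 : ℚ) := by
    refine (minpoly.eq_of_irreducible_of_monic irreducible_f13 ?_ (by monicity!)).symm
    simp only [map_add, map_mul, aeval_X_pow, aeval_X, map_one, map_neg, map_ofNat]
    linear_combination per13_cubic
  rw [IntermediateField.adjoin.finrank hint, hmin]
  compute_degree!

/-- `[ℚ(η₁₀₃) : ℚ] = 3`: `f₁₀₃` is irreducible, hence the minimal polynomial of `η₁₀₃`.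
[folklore] -/
theorem finrank_adjoin_per103 : Module.finrank ℚ ℚ⟮per103⟯ = 3 := by
  have hint : IsIntegral ℚ per103 := .of_finite ℚ per103
  have hmin :
      minpoly ℚ per103 = X ^ 3 + C (1 : ℚ) * X ^ 2 + C (-34 : ℚ) * X + C (-61 : ℚ) := by
    refine (minpoly.eq_of_irreducible_of_monic irreducible_f103 ?_ (by monicity!)).symm
    simp only [map_add, map_mul, aeval_X_pow, aeval_X, map_one, map_neg, map_ofNat]
    linear_combination per103_cubic
  rw [IntermediateField.adjoin.finrank hint, hmin]
  compute_degree!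

/-- `η₁₃ ∈ F₃`. [cite: DokchitserDokchitser2011RankModN, proof of Thm. 2] -/
theorem per13_mem_F₃ : per13 ∈ F₃ := mem_F₃_of_finrank_adjoin_eq_three finrank_adjoin_per13

/-- `η₁₀₃ ∈ F₃`. [cite: DokchitserDokchitser2011RankModN, proof of Thm. 2] -/
theorem per103_mem_F₃ : per103 ∈ F₃ :=
  mem_F₃_of_finrank_adjoin_eq_three finrank_adjoin_per103

namespace F₃

/-- The Gaussian period `η₁₃` as an element `A` of `F₃` (a root of `f₁₃` generating the cubic
subfield `K₁₃ = F₃ ∩ ℚ(ζ₁₃)`). [cite: DokchitserDokchitser2011RankModN, proof of Thm. 2] -/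
def A : F₃ := ⟨per13, per13_mem_F₃⟩

/-- The Gaussian period `η₁₀₃` as an element `B` of `F₃` (a root of `f₁₀₃` generating the cubic
subfield `K₁₀₃ = F₃ ∩ ℚ(ζ₁₀₃)`). [cite: DokchitserDokchitser2011RankModN, proof of Thm. 2] -/
def B : F₃ := ⟨per103, per103_mem_F₃⟩

/-- `A` is a root of `f₁₃` in `F₃`. [folklore] -/
theorem A_cubic : A ^ 3 + A ^ 2 - 4 * A + 1 = 0 := by
  apply Subtype.ext
  change ((A : Cyclotomic1339) ^ 3 + (A : Cyclotomic1339) ^ 2 - 4 * (A : Cyclotomic1339) + 1 :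
    Cyclotomic1339) = 0
  exact per13_cubic

/-- `B` is a root of `f₁₀₃` in `F₃`. [folklore] -/
theorem B_cubic : B ^ 3 + B ^ 2 - 34 * B - 61 = 0 := by
  apply Subtype.ext
  change ((B : Cyclotomic1339) ^ 3 + (B : Cyclotomic1339) ^ 2 - 34 * (B : Cyclotomic1339) - 61 :
    Cyclotomic1339) = 0
  exact per103_cubic

/-- Every `σ ∈ Gal(F₃/ℚ)` maps `A` to one of `A, A', A''`. [folklore] -/
theorem apply_A_cases (σ : Gal(F₃/ℚ)) :
    σ A = A ∨ σ A = conj13 A ∨ σ A = conj13 (conj13 A) := by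
  refine eq_conj13_of_root A_cubic ?_
  have h := congrArg σ A_cubic
  simpa [map_add, map_sub, map_mul, map_pow, map_ofNat] using h

/-- Every `σ ∈ Gal(F₃/ℚ)` maps `B` to one of `B, B', B''`. [folklore] -/
theorem apply_B_cases (σ : Gal(F₃/ℚ)) :
    σ B = B ∨ σ B = conj103 B ∨ σ B = conj103 (conj103 B) := by
  refine eq_conj103_of_root B_cubic ?_
  have h := congrArg σ B_cubic
  simpa [map_add, map_sub, map_mul, map_pow, map_ofNat] using h

/-- **The generators `θ'`, `θ''` of the two cubic subfields of `F₃` of conductor `1339`**, and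
the case analysis: every `σ ∈ Gal(F₃/ℚ)` fixes one of `A`, `B`, `θ' = theta1339a A B`,
`θ'' = theta1339b A B` — according as `(σA, σB) = (A, ·)`, `(·, B)`, `(A', B')`/`(A'', B'')`, or
`(A', B'')`/`(A'', B')`. (So the fixed field `F₃^{⟨σ⟩}` of any `σ` contains a root of one of the
four cubics `f₁₃, f₁₀₃, f', f''`; for `σ ≠ 1` these are the four cubic subfields of `F₃`, the
"minimal non-trivial subfields" of the source.)
[cite: DokchitserDokchitser2011RankModN, proof of Thm. 2] -/
theorem apply_eq_self_cases (σ : Gal(F₃/ℚ)) :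
    σ A = A ∨ σ B = B ∨ σ (theta1339a A B) = theta1339a A B ∨
      σ (theta1339b A B) = theta1339b A B := by
  have hA := A_cubic
  have hB := B_cubic
  have ha : σ (theta1339a A B) = theta1339a (σ A) (σ B) :=
    map_theta1339a (σ : F₃ →+* F₃) A B
  have hb : σ (theta1339b A B) = theta1339b (σ A) (σ B) :=
    map_theta1339b (σ : F₃ →+* F₃) A B
  rcases apply_A_cases σ with h1 | h1 | h1
  · exact Or.inl h1
  rcases apply_B_cases σ with h2 | h2 | h2
  · exact Or.inr (Or.inl h2)
  -- `(A', B')`: `θ'` is fixed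
  · refine Or.inr (Or.inr (Or.inl ?_))
    rw [ha, h1, h2, theta1339a_conj hA hB]
  -- `(A', B'')`: `θ''` is fixed
  · refine Or.inr (Or.inr (Or.inr ?_))
    rw [hb, h1, h2, theta1339b_conj hA hB]
  rcases apply_B_cases σ with h2 | h2 | h2
  · exact Or.inr (Or.inl h2)
  -- `(A'', B')`: `θ''` is fixed (apply the anti-diagonal invariance twice)
  · refine Or.inr (Or.inr (Or.inr ?_))
    have e1 := theta1339b_conj hA hB
    have e2 := theta1339b_conj (conj13_root hA) (conj103_root (conj103_root hB))
    rw [conj103_conj103_conj103 hB] at e2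
    rw [hb, h1, h2, e2, e1]
  -- `(A'', B'')`: `θ'` is fixed (apply the diagonal invariance twice)
  · refine Or.inr (Or.inr (Or.inl ?_))
    have e1 := theta1339a_conj hA hB
    have e2 := theta1339a_conj (conj13_root hA) (conj103_root hB)
    rw [ha, h1, h2, e2, e1]

/-- **Each fixed field `K_σ = F₃^{⟨σ⟩}` contains a root of one of the four cubics**
`f₁₃ = X³ + X² - 4X + 1`, `f₁₀₃ = X³ + X² - 34X - 61`, `f' = X³ + X² - 446X + 248`,
`f'' = X³ + X² - 446X - 3769` (for `σ ≠ 1`, `K_σ` is then the cubic field generated by it).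
[cite: DokchitserDokchitser2011RankModN, proof of Thm. 2] -/
theorem exists_root_mem_cubicField (σ : Gal(F₃/ℚ)) :
    (∃ θ : cubicField σ, θ ^ 3 + θ ^ 2 - 4 * θ + 1 = 0) ∨
    (∃ θ : cubicField σ, θ ^ 3 + θ ^ 2 - 34 * θ - 61 = 0) ∨
    (∃ θ : cubicField σ, θ ^ 3 + θ ^ 2 - 446 * θ + 248 = 0) ∨
    (∃ θ : cubicField σ, θ ^ 3 + θ ^ 2 - 446 * θ - 3769 = 0) := by
  rcases apply_eq_self_cases σ with h | h | h | h
  · refine Or.inl ⟨⟨A, mem_cubicField_of_apply_eq h⟩, Subtype.ext ?_⟩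
    push_cast
    exact A_cubic
  · refine Or.inr (Or.inl ⟨⟨B, mem_cubicField_of_apply_eq h⟩, Subtype.ext ?_⟩)
    push_cast
    exact B_cubic
  · refine Or.inr (Or.inr (Or.inl ⟨⟨_, mem_cubicField_of_apply_eq h⟩, Subtype.ext ?_⟩))
    push_cast
    exact theta1339a_cubic A_cubic B_cubic
  · refine Or.inr (Or.inr (Or.inr ⟨⟨_, mem_cubicField_of_apply_eq h⟩, Subtype.ext ?_⟩))
    push_cast
    exact theta1339b_cubic A_cubic B_cubic

end F₃

/-! ### The fact from the four cubic `2`-descents over the model fields -/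

set_option backward.isDefEq.respectTransparency false in
/-- **Reduction of the four cubic `2`-descents to the four explicit cubics.** If for each of the
four polynomials `f ∈ {f₁₃, f₁₀₃, f', f''}` every cyclic cubic number field `K` (Galois of degree
`3` over `ℚ`) containing a root of `f` has `rk_ℤ E(K) ≤ 1` for `E = 480a1`, then
`DokchitserDokchitser2011_descent_480a1_F3_cubic` holds: each `K_σ = F₃^{⟨σ⟩}` (`σ ≠ 1`) is
Galois of degree `3` over `ℚ` (`F₃/ℚ` abelian; `F₃.finrank_cubicField`) and contains a root of
one of them (`F₃.exists_root_mem_cubicField`). [cite: DokchitserDokchitser2011RankModN, proof of Thm. 2] -/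
theorem descent_480a1_F3_cubic_of_cubics
    (h13 : ∀ (K : Type) [Field K] [NumberField K] [IsGalois ℚ K],
      Module.finrank ℚ K = 3 → ∀ θ : K, θ ^ 3 + θ ^ 2 - 4 * θ + 1 = 0 →
        (curve480a1.baseChange K).mordellWeilRank ≤ 1)
    (h103 : ∀ (K : Type) [Field K] [NumberField K] [IsGalois ℚ K],
      Module.finrank ℚ K = 3 → ∀ θ : K, θ ^ 3 + θ ^ 2 - 34 * θ - 61 = 0 →
        (curve480a1.baseChange K).mordellWeilRank ≤ 1)
    (h1339a : ∀ (K : Type) [Field K] [NumberField K] [IsGalois ℚ K],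
      Module.finrank ℚ K = 3 → ∀ θ : K, θ ^ 3 + θ ^ 2 - 446 * θ + 248 = 0 →
        (curve480a1.baseChange K).mordellWeilRank ≤ 1)
    (h1339b : ∀ (K : Type) [Field K] [NumberField K] [IsGalois ℚ K],
      Module.finrank ℚ K = 3 → ∀ θ : K, θ ^ 3 + θ ^ 2 - 446 * θ - 3769 = 0 →
        (curve480a1.baseChange K).mordellWeilRank ≤ 1) :
    DokchitserDokchitser2011_descent_480a1_F3_cubic := by
  intro σ hσ
  haveI : IsAbelianGalois ℚ F₃ := inferInstance
  haveI : IsGalois ℚ (F₃.cubicField σ) :=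
    IsGalois.of_fixedField_normal_subgroup (Subgroup.zpowers σ)
  have hdeg := F₃.finrank_cubicField hσ
  rcases F₃.exists_root_mem_cubicField σ with
    ⟨θ, hθ⟩ | ⟨θ, hθ⟩ | ⟨θ, hθ⟩ | ⟨θ, hθ⟩
  · exact h13 _ hdeg θ hθ
  · exact h103 _ hdeg θ hθ
  · exact h1339a _ hdeg θ hθ
  · exact h1339b _ hdeg θ hθ

end DokchitserDokchitser2011

end Literature.Barriers.BirchSwinnertonDyer

end
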